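import Literature.NumberTheory.LFunctions.WeilWindowForm
import Literature.NumberTheory.LFunctions.WeilWindowSuzukiProofs
import Literature.NumberTheory.LFunctions.WeilWindowSuzukiAsymptoticProofs
import HarnessLib

/-!
# Format C (Fourier–Galerkin certificates of Weil positivity): window functions — increment bounds,
  measurability

Helper file (`--supports stmt-RiemannHypothesis-0098`, lead-track anchor; infrastructure for the
Weil-positivity window ladder), RH-free. Seat rh-explicit-weil-3 (gen3). Normalisation of
`Literature/NumberTheory/LFunctions/WeilWindowForm.lean`: `weilWindowForm a u = P(u) + 𝓔_a(u) − M_a‖u‖₂²`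
(`= Re Q(u)` for test functions supported in `[-a, a]`).

A **window function** is a measurable `u : ℝ → ℂ` vanishing off `[-a, a]`, bounded (`‖u‖ ≤ S₀`) and
`S₁`-Lipschitz ON the closed window (jumps at `±a` allowed) — e.g. a trigonometric polynomial, or any
smooth `2a`-periodic function, cut off at the window (Yoshida's `K(a)`).

## Contents (sorry-free)

* increment bounds `D_t(u) ≤ 2aS₁²t² + 2S₀²t` (`t ≥ 0`; interior `O(t²)`, the two jumps `O(t)`) and
  `D_t(u) ≤ 8aS₀²`; integrability of the increment integrand; measurability of `t ↦ D_t(u)`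
  (the archimedean density's is `measurable_weilArchDensity` of `WeilWindowSuzukiAsymptoticProofs`);

The convergence theorem `tendsto_weilWindowForm_of_uniform` (continuity of the window form along a
uniformly convergent window family) is the sequel `WeilFormatCWindowLimit.lean`; the dictionary
"positivity on the trigonometric windows ⟹ `WeilPositivityOn a`" is `WeilFormatCWindowDictionary.lean`.
-/

set_option autoImplicit false
set_option linter.dupNamespace false  -- the mandated namespace repeats `RiemannHypothesis`

noncomputable section

open Complex Filter Set MeasureTheory
open scoped Real Topology ComplexConjugate ArithmeticFunction.vonMangoldt

namespace Summit.RiemannHypothesis.RiemannHypothesis.Theorems.WeilFormatC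

open Literature.NumberTheory.LFunctions

/-! ## Window functions: increment bounds and measurability -/

section WindowFamily

variable {a : ℝ} {u : ℝ → ℂ} {S₀ S₁ : ℝ}

/-- Outside the closed window `[-a, a]` one has `a < |x|`. -/
theorem lt_abs_of_not_mem_Icc_window {x : ℝ} (hx : x ∉ Icc (-a) a) : a < |x| := by
  rw [mem_Icc, not_and_or, not_le, not_le] at hx
  rcases hx with h | h
  · have : -x ≤ |x| := neg_le_abs x
    linarith
  · exact h.trans_le (le_abs_self x)

/-- Pointwise increment bound for a window function (`u = 0` off `[-a,a]`, `‖u‖ ≤ S₀`,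
`S₁`-Lipschitz on the window), `t ≥ 0`:
`‖u(x+t) − u(x)‖² ≤ (S₁t)² 𝟙_{[-a,a]}(x) + S₀² (𝟙_{[-a-t,-a]}(x) + 𝟙_{[a-t,a]}(x))`. -/
theorem norm_sub_sq_le_window_bound (hz : ∀ x, x ∉ Icc (-a) a → u x = 0)
    (hb : ∀ x, ‖u x‖ ≤ S₀)
    (hl : ∀ x y, x ∈ Icc (-a) a → y ∈ Icc (-a) a → ‖u y - u x‖ ≤ S₁ * |y - x|)
    {t : ℝ} (ht : 0 ≤ t) (x : ℝ) :
    ‖u (x + t) - u x‖ ^ 2 ≤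
      (S₁ * t) ^ 2 * (Icc (-a) a).indicator 1 x +
        S₀ ^ 2 * ((Icc (-a - t) (-a)).indicator 1 x + (Icc (a - t) a).indicator 1 x) := by
  have hS₀ : 0 ≤ S₀ := (norm_nonneg _).trans (hb 0)
  have i1 : 0 ≤ (Icc (-a) a).indicator (1 : ℝ → ℝ) x := Set.indicator_nonneg (fun _ _ ↦ zero_le_one) _
  have i2 : 0 ≤ (Icc (-a - t) (-a)).indicator (1 : ℝ → ℝ) x :=
    Set.indicator_nonneg (fun _ _ ↦ zero_le_one) _
  have i3 : 0 ≤ (Icc (a - t) a).indicator (1 : ℝ → ℝ) x := Set.indicator_nonneg (fun _ _ ↦ zero_le_one) _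
  by_cases hx : x ∈ Icc (-a) a
  · by_cases hxt : x + t ∈ Icc (-a) a
    · -- both inside: Lipschitz
      have h := hl x (x + t) hx hxt
      rw [show x + t - x = t by ring, abs_of_nonneg ht] at h
      have h2 : ‖u (x + t) - u x‖ ^ 2 ≤ (S₁ * t) ^ 2 := by
        have h0 : 0 ≤ ‖u (x + t) - u x‖ := norm_nonneg _
        nlinarith
      rw [indicator_of_mem hx, Pi.one_apply, mul_one]
      nlinarith
    · -- x inside, x + t outside: x ∈ [a - t, a]
      have hxat : x ∈ Icc (a - t) a := by
        refine ⟨?_, hx.2⟩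
        rw [mem_Icc, not_and_or, not_le, not_le] at hxt
        rcases hxt with h | h
        · linarith [hx.1]
        · linarith
      rw [hz _ hxt, zero_sub, norm_neg, indicator_of_mem hxat, Pi.one_apply]
      have h2 : ‖u x‖ ^ 2 ≤ S₀ ^ 2 := by
        have := hb x
        have h0 : 0 ≤ ‖u x‖ := norm_nonneg _
        nlinarith
      nlinarith
  · by_cases hxt : x + t ∈ Icc (-a) a
    · -- x outside, x + t inside: x ∈ [-a - t, -a]
      have hxat : x ∈ Icc (-a - t) (-a) := by
        refine ⟨by linarith [hxt.1], ?_⟩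
        rw [mem_Icc, not_and_or, not_le, not_le] at hx
        rcases hx with h | h
        · linarith
        · linarith [hxt.2]
      rw [hz _ hx, sub_zero, indicator_of_mem hxat, Pi.one_apply]
      have h2 : ‖u (x + t)‖ ^ 2 ≤ S₀ ^ 2 := by
        have := hb (x + t)
        have h0 : 0 ≤ ‖u (x + t)‖ := norm_nonneg _
        nlinarith
      nlinarith
    · rw [hz _ hx, hz _ hxt, sub_zero, norm_zero]
      nlinarith

/-- Crude pointwise increment bound for a bounded function vanishing off `[-a,a]`:
`‖u(x+t) − u(x)‖² ≤ 2S₀² (𝟙_{[-a,a]}(x+t) + 𝟙_{[-a,a]}(x))`. -/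
theorem norm_sub_sq_le_window_bound' (hz : ∀ x, x ∉ Icc (-a) a → u x = 0)
    (hb : ∀ x, ‖u x‖ ≤ S₀) (t x : ℝ) :
    ‖u (x + t) - u x‖ ^ 2 ≤
      2 * S₀ ^ 2 * ((Icc (-a) a).indicator 1 (x + t) + (Icc (-a) a).indicator 1 x) := by
  have hS₀ : 0 ≤ S₀ := (norm_nonneg _).trans (hb 0)
  have key : ∀ y, ‖u y‖ ^ 2 ≤ S₀ ^ 2 * (Icc (-a) a).indicator 1 y := by
    intro y
    by_cases hy : y ∈ Icc (-a) a
    · rw [indicator_of_mem hy, Pi.one_apply, mul_one]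
      have := hb y
      have h0 : 0 ≤ ‖u y‖ := norm_nonneg _
      nlinarith
    · rw [hz y hy, indicator_of_notMem hy, norm_zero, mul_zero]
      simp
  have htri : ‖u (x + t) - u x‖ ^ 2 ≤ 2 * ‖u (x + t)‖ ^ 2 + 2 * ‖u x‖ ^ 2 := by
    have h := norm_sub_le (u (x + t)) (u x)
    have h0 : 0 ≤ ‖u (x + t) - u x‖ := norm_nonneg _
    nlinarith [sq_nonneg (‖u (x + t)‖ - ‖u x‖)]
  have k1 := key (x + t)
  have k2 := key x
  linarith

/-- The increment integrand of a bounded measurable function vanishing off `[-a,a]` is integrable. -/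
theorem integrable_norm_sub_sq_window (hm : Measurable u) (hz : ∀ x, x ∉ Icc (-a) a → u x = 0)
    (hb : ∀ x, ‖u x‖ ≤ S₀) (t : ℝ) : Integrable fun x : ℝ ↦ ‖u (x + t) - u x‖ ^ 2 := by
  have hmeas : AEStronglyMeasurable (fun x : ℝ ↦ ‖u (x + t) - u x‖ ^ 2) volume :=
    (((hm.comp (measurable_id.add_const t)).sub hm).norm.pow_const 2).aestronglyMeasurable
  have hint : Integrable (fun x : ℝ ↦
      2 * S₀ ^ 2 * ((Icc (-a) a).indicator 1 (x + t) + (Icc (-a) a).indicator 1 x)) := by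
    refine Integrable.const_mul (Integrable.add ?_ ?_) _
    · exact ((integrable_indicator_iff measurableSet_Icc).2
        (integrableOn_const (by simp [Real.volume_Icc]))).comp_add_right t
    · exact (integrable_indicator_iff measurableSet_Icc).2 (integrableOn_const (by simp [Real.volume_Icc]))
  refine hint.mono' hmeas (Eventually.of_forall fun x ↦ ?_)
  rw [Real.norm_of_nonneg (by positivity)]
  exact norm_sub_sq_le_window_bound' hz hb t x

/-- `D_t(u) ≤ 8a S₀²` for a bounded measurable function vanishing off `[-a,a]` (`a ≥ 0`). -/
theorem weilIncrement_le_window_const (ha : 0 ≤ a) (hm : Measurable u)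
    (hz : ∀ x, x ∉ Icc (-a) a → u x = 0) (hb : ∀ x, ‖u x‖ ≤ S₀) (t : ℝ) :
    weilIncrement u t ≤ 8 * a * S₀ ^ 2 := by
  unfold weilIncrement
  have hI1 : Integrable fun x : ℝ ↦ (Icc (-a) a).indicator (1 : ℝ → ℝ) x :=
    (integrable_indicator_iff measurableSet_Icc).2 (integrableOn_const (by simp [Real.volume_Icc]))
  have hI2 : Integrable fun x : ℝ ↦ (Icc (-a) a).indicator (1 : ℝ → ℝ) (x + t) := hI1.comp_add_right t
  calc ∫ x, ‖u (x + t) - u x‖ ^ 2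
      ≤ ∫ x, 2 * S₀ ^ 2 * ((Icc (-a) a).indicator 1 (x + t) + (Icc (-a) a).indicator 1 x) :=
        integral_mono (integrable_norm_sub_sq_window hm hz hb t) ((hI2.add hI1).const_mul _)
          fun x ↦ norm_sub_sq_le_window_bound' hz hb t x
    _ = 2 * S₀ ^ 2 * (2 * a + 2 * a) := by
        rw [integral_const_mul, integral_add hI2 hI1,
          integral_add_right_eq_self (fun x ↦ (Icc (-a) a).indicator (1 : ℝ → ℝ) x) t,
          integral_indicator_one measurableSet_Icc, Real.volume_real_Icc_of_le (by linarith)]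
        ring
    _ = 8 * a * S₀ ^ 2 := by ring

/-- `D_t(u) ≤ 2a S₁² t² + 2 S₀² t` (`t ≥ 0`) for a window function that is `S₁`-Lipschitz on
`[-a,a]` (the jump at `±a` costs `O(t)`, the interior `O(t²)`). -/
theorem weilIncrement_le_window_linear (ha : 0 ≤ a) (hm : Measurable u)
    (hz : ∀ x, x ∉ Icc (-a) a → u x = 0) (hb : ∀ x, ‖u x‖ ≤ S₀)
    (hl : ∀ x y, x ∈ Icc (-a) a → y ∈ Icc (-a) a → ‖u y - u x‖ ≤ S₁ * |y - x|)
    {t : ℝ} (ht : 0 ≤ t) :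
    weilIncrement u t ≤ 2 * a * S₁ ^ 2 * t ^ 2 + 2 * S₀ ^ 2 * t := by
  unfold weilIncrement
  have hI : ∀ c d : ℝ, Integrable fun x : ℝ ↦ (Icc c d).indicator (1 : ℝ → ℝ) x := fun c d ↦
    (integrable_indicator_iff measurableSet_Icc).2 (integrableOn_const (by simp [Real.volume_Icc]))
  have hA : Integrable fun x : ℝ ↦ (S₁ * t) ^ 2 * (Icc (-a) a).indicator 1 x :=
    (hI _ _).const_mul _
  have hB0 : Integrable fun x : ℝ ↦
      (Icc (-a - t) (-a)).indicator (1 : ℝ → ℝ) x + (Icc (a - t) a).indicator (1 : ℝ → ℝ) x :=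
    (hI _ _).add (hI _ _)
  have hB : Integrable fun x : ℝ ↦
      S₀ ^ 2 * ((Icc (-a - t) (-a)).indicator 1 x + (Icc (a - t) a).indicator 1 x) :=
    hB0.const_mul _
  have hG : Integrable fun x : ℝ ↦ (S₁ * t) ^ 2 * (Icc (-a) a).indicator 1 x +
      S₀ ^ 2 * ((Icc (-a - t) (-a)).indicator 1 x + (Icc (a - t) a).indicator 1 x) := hA.add hB
  calc ∫ x, ‖u (x + t) - u x‖ ^ 2
      ≤ ∫ x, (S₁ * t) ^ 2 * (Icc (-a) a).indicator 1 x +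
          S₀ ^ 2 * ((Icc (-a - t) (-a)).indicator 1 x + (Icc (a - t) a).indicator 1 x) :=
        integral_mono (integrable_norm_sub_sq_window hm hz hb t) hG
          fun x ↦ norm_sub_sq_le_window_bound hz hb hl ht x
    _ = (S₁ * t) ^ 2 * (2 * a) + S₀ ^ 2 * (t + t) := by
        rw [integral_add hA hB, integral_const_mul, integral_const_mul, integral_add (hI _ _) (hI _ _),
          integral_indicator_one measurableSet_Icc, integral_indicator_one measurableSet_Icc,
          integral_indicator_one measurableSet_Icc, Real.volume_real_Icc_of_le (by linarith),
          Real.volume_real_Icc_of_le (by linarith), Real.volume_real_Icc_of_le (by linarith)]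
        ring
    _ = 2 * a * S₁ ^ 2 * t ^ 2 + 2 * S₀ ^ 2 * t := by ring

/-- `t ↦ D_t(u)` is measurable for measurable `u` (a parametric Bochner integral). -/
theorem measurable_weilIncrement (hm : Measurable u) : Measurable (weilIncrement u) := by
  have h : Measurable (Function.uncurry fun t x : ℝ ↦ ‖u (x + t) - u x‖ ^ 2) := by
    have h1 : Measurable fun p : ℝ × ℝ ↦ u (p.2 + p.1) := hm.comp (measurable_snd.add measurable_fst)
    have h2 : Measurable fun p : ℝ × ℝ ↦ u p.2 := hm.comp measurable_snd
    exact ((h1.sub h2).norm).pow_const 2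
  exact (h.stronglyMeasurable.integral_prod_right (ν := volume)).measurable

end WindowFamily

end Summit.RiemannHypothesis.RiemannHypothesis.Theorems.WeilFormatC

end
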